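import Literature.NumberTheory.LFunctions.DworkRationalityBorelDwork
import Mathlib.RingTheory.PowerSeries.Order
import Mathlib.RingTheory.PowerSeries.NoZeroDivisors
import Mathlib.NumberTheory.Padics.Complex
import HarnessLib

/-!
# Route `AdditiveBranchIMC` (rung K1), cruxes 19357 / 19358 / 19359, stub `stub_tameGreenbergInclusion{R0,M}` (skeleton v21):
# a two-variable inclusion AWAY FROM THE CYCLOTOMIC VARIABLE specialises, on the anticyclotomic line, to an
# inclusion UP TO A POWER OF `p` (pure algebra in `𝒪_{ℂ_p}⟦T₂⟧⟦T₁⟧`)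

Cell `bsd-addord`, LEAD seat `cruxlead-19357` (gen 7), `Cruxes/GordTwoRankZeroOffCaseOne/LeadReport14.md` §3. THEOREMS ONLY (no
definition, no named fact, no `sorry`). Context: the refereed two-variable divisibilities with a free branch character
(Castella–Liu–Wan, Forum Math. Sigma 10 (2022) e110, Thm. 8.2.1 (1): «`(𝓛) ⊇ char(X)` as fractional ideals of
`𝒪^{ur}⟦Γ_𝒦⟧ ⊗_{𝒪⟦Γ⁺⟧} Frac 𝒪⟦Γ⁺⟧`»; Wan 2020 print Thm. 1.1 after `𝕀 → 𝒪`) give `h(T₁)·char(X) ⊆ (G)` for SOME non-zero power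
series `h` in the cyclotomic variable `T₁` ALONE — the OUTER variable of the tree's receptacle
`PowerSeries (PowerSeries (PadicComplexInt p)) = 𝒪_{ℂ_p}⟦T₂⟧⟦T₁⟧`, killed by `π = PowerSeries.constantCoeff` (the anticyclotomic
specialisation `T₁ ↦ 0` of `TameSpecialization.S2L`). What the port reads (v21 `TameGreenbergInclusionAt`,
`charIdeal_XAc_map_le_span_of_twoVarSpec`) is `C(p^k)·π(char X) ⊆ (π G)`. This file proves the passage:

* `mem_span_of_X_pow_mul_mem_span` — over a domain `B`, in `B⟦X⟧`: if `G(0) ≠ 0` then `X^a·u ∈ (G) ⟹ u ∈ (G)` (`X` is prime and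
  does not divide `G`);
* `exists_pow_eq_mul` — every non-zero `c ∈ 𝒪_{ℂ_p}` divides a power of `p` (`‖c‖ > 0`);
* `exists_C_pow_mul_mem_span_constantCoeff` — THE SPECIALISATION: `h ≠ 0` in `𝒪_{ℂ_p}⟦T₁⟧`, `G(0, T₂) ≠ 0`, and
  `(map C h)·y ∈ (G)` for all `y ∈ I` ⟹ `∃ k, ∀ w ∈ π(I), C(p^k)·w ∈ (π G)`: write `h = T₁^a h₁` with `h₁(0) ≠ 0`
  (`X_pow_order_mul_divXPowOrder`), cancel `T₁^a`, apply `π`, and absorb `h₁(0)` into a power of `p`.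

References: F. Castella, Z. Liu, X. Wan, Forum Math. Sigma 10 (2022) e110, Thm. 8.2.1; X. Wan, ANT 14 (2020) Thm. 1.1;
N. Bourbaki, *Algèbre commutative* Ch. 5–7, VII §3 (power series over a domain: `X` prime) [BourbakiAC5to7].
-/

set_option linter.dupNamespace false
set_option autoImplicit false

noncomputable section

open scoped Classical

open PowerSeries

namespace Summit.BirchSwinnertonDyer.BirchSwinnertonDyer.Theorems.TameAwayFromCyc

/-! ### §1 Cancelling a power of the variable against a series with non-zero constant term -/

/-- Over a domain `B`: if `G ∈ B⟦X⟧` has `G(0) ≠ 0` (so `X ∤ G`) and `X^a · u ∈ (G)`, then `u ∈ (G)` — `X` is a prime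
element of `B⟦X⟧`. [cite: BourbakiAC5to7, VII §3 no. 8 (formal power series over an integral domain)] -/
theorem mem_span_of_X_pow_mul_mem_span {B : Type*} [CommRing B] [IsDomain B] {G u : B⟦X⟧}
    (hG : constantCoeff G ≠ 0) (a : ℕ) (h : X ^ a * u ∈ Ideal.span {G}) : u ∈ Ideal.span {G} := by
  rw [Ideal.mem_span_singleton] at h ⊢
  obtain ⟨z, hz⟩ := h
  have hXG : ¬ (X : B⟦X⟧) ∣ G := by rwa [X_dvd_iff]
  have hXz : (X : B⟦X⟧) ^ a ∣ z :=
    X_prime.pow_dvd_of_dvd_mul_left a hXG ⟨u, by rw [← hz, mul_comm]⟩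
  obtain ⟨z', rfl⟩ := hXz
  refine ⟨z', mul_left_cancel₀ (pow_ne_zero a X_ne_zero) ?_⟩
  rw [hz]; ring

/-! ### §2 Non-zero elements of `𝒪_{ℂ_p}` divide a power of `p` -/

variable {p : ℕ} [hp : Fact p.Prime]

/-- Every non-zero `c ∈ 𝒪_{ℂ_p}` divides some `p^k` in `𝒪_{ℂ_p}`: `‖c‖ > 0`, so `‖p‖^k ≤ ‖c‖` for `k` large and
`p^k / c` lies in the unit ball. [folklore] [cite: Koblitz1984, Ch. III §4] -/
theorem exists_pow_eq_mul (c : PadicComplexInt p) (hc : c ≠ 0) :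
    ∃ (k : ℕ) (d : PadicComplexInt p), ((p : ℕ) : PadicComplexInt p) ^ k = c * d := by
  have hpr : p.Prime := hp.out
  have hc0 : (c : ℂ_[p]) ≠ 0 := fun h ↦ hc (Subtype.ext h)
  have hcpos : 0 < ‖(c : ℂ_[p])‖ := norm_pos_iff.mpr hc0
  have hplt : ‖((p : ℕ) : ℂ_[p])‖ < 1 := by
    rw [show ((p : ℕ) : ℂ_[p]) = algebraMap ℚ_[p] ℂ_[p] (p : ℚ_[p]) by simp, norm_algebraMap',
      Padic.norm_p]
    exact inv_lt_one_of_one_lt₀ (by exact_mod_cast hpr.one_lt)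
  obtain ⟨k, hk⟩ := exists_pow_lt_of_lt_one hcpos hplt
  set d : ℂ_[p] := ((p : ℕ) : ℂ_[p]) ^ k / (c : ℂ_[p]) with hd
  have hdn : ‖d‖ ≤ 1 := by
    rw [hd, norm_div, norm_pow, div_le_one hcpos]
    exact hk.le
  have hdmem : d ∈ Literature.NumberTheory.LFunctions.Dwork.unitBall p :=
    Literature.NumberTheory.LFunctions.Dwork.mem_unitBall.mpr hdn
  refine ⟨k, ⟨d, hdmem⟩, Subtype.ext ?_⟩
  change (((p : ℕ) : PadicComplexInt p) ^ k : PadicComplexInt p).1 = (c : ℂ_[p]) * d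
  rw [hd, mul_div_cancel₀ _ hc0]
  simp

/-! ### §3 The specialisation `T₁ ↦ 0` of an inclusion away from `T₁` -/

/-- **Away from the cyclotomic variable ⟹ up to a power of `p` on the anticyclotomic line.** In `𝒪_{ℂ_p}⟦T₂⟧⟦T₁⟧` (outer variable
`T₁`, `π = constantCoeff : T₁ ↦ 0`): let `I` be an ideal, `G` a series with `π G ≠ 0`, and `h ∈ 𝒪_{ℂ_p}⟦T₁⟧` NON-ZERO (embedded with
constant inner coefficients, `PowerSeries.map C h`) with `(map C h)·y ∈ (G)` for every `y ∈ I`. Then for some `k`, `C(p^k)·w ∈ (π G)` for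
every `w ∈ π(I)`. (Write `h = T₁^a·h₁`, `h₁(0) ≠ 0`; `T₁` is prime and `T₁ ∤ G`, so `h₁·y ∈ (G)`; apply `π`: `h₁(0)·π y ∈ (π G)`; and
`h₁(0) ∣ p^k`.) [cite: CastellaLiuWan2022, Thm. 8.2.1 (1) (the shape «fractional ideals of 𝒪^{ur}⟦Γ_𝒦⟧ ⊗_{𝒪⟦Γ⁺⟧} Frac 𝒪⟦Γ⁺⟧»)] -/
theorem exists_C_pow_mul_mem_span_constantCoeff (I : Ideal (PowerSeries (PowerSeries (PadicComplexInt p))))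
    (G : PowerSeries (PowerSeries (PadicComplexInt p)))
    (hG : constantCoeff G ≠ 0) (h : PowerSeries (PadicComplexInt p)) (hh : h ≠ 0)
    (hincl : ∀ y ∈ I,
      PowerSeries.map (PowerSeries.C : PadicComplexInt p →+* PowerSeries (PadicComplexInt p)) h * y ∈
        Ideal.span {G}) :
    ∃ k : ℕ, ∀ w ∈ I.map (PowerSeries.constantCoeff (R := PowerSeries (PadicComplexInt p))),
      PowerSeries.C (((p : ℕ) : PadicComplexInt p) ^ k) * w ∈ Ideal.span {PowerSeries.constantCoeff G} := by
  set Cc : PadicComplexInt p →+* PowerSeries (PadicComplexInt p) := PowerSeries.C with hCc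
  -- `h = T₁^a · h₁`, `h₁(0) ≠ 0`
  set a : ℕ := h.order.toNat with ha
  set h₁ : PowerSeries (PadicComplexInt p) := divXPowOrder h with hh₁
  have hfac : X ^ a * h₁ = h := X_pow_order_mul_divXPowOrder
  have hc : constantCoeff h₁ ≠ 0 := fun h0 ↦ hh (constantCoeff_divXPowOrder_eq_zero_iff.mp h0)
  set c : PadicComplexInt p := constantCoeff h₁ with hcdef
  -- `(map C h₁) · y ∈ (G)` for `y ∈ I`
  have hincl₁ : ∀ y ∈ I, PowerSeries.map Cc h₁ * y ∈ Ideal.span {G} := by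
    intro y hy
    have h1 := hincl y hy
    rw [← hfac, map_mul, map_pow, map_X, mul_assoc] at h1
    exact mem_span_of_X_pow_mul_mem_span hG a h1
  -- apply `π`: `C(c) · π y ∈ (π G)`
  have hπ : ∀ y ∈ I, PowerSeries.C c * constantCoeff y ∈ Ideal.span {constantCoeff G} := by
    intro y hy
    obtain ⟨z, hz⟩ := Ideal.mem_span_singleton'.mp (hincl₁ y hy)
    have h2 := congrArg (PowerSeries.constantCoeff (R := PowerSeries (PadicComplexInt p))) hz
    have hCm : PowerSeries.constantCoeff (PowerSeries.map Cc h₁) = Cc c := by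
      rw [← PowerSeries.coeff_zero_eq_constantCoeff_apply, PowerSeries.coeff_map,
        PowerSeries.coeff_zero_eq_constantCoeff_apply]
    rw [map_mul, map_mul, hCm] at h2
    -- `h2 : π z * π G = Cc (h₁ 0) * π y`
    refine Ideal.mem_span_singleton'.mpr ⟨constantCoeff z, ?_⟩
    rw [h2]
  -- absorb `c` into a power of `p`
  obtain ⟨k, d, hkd⟩ := exists_pow_eq_mul c hc
  refine ⟨k, fun w hw ↦ ?_⟩
  rw [Ideal.map] at hw
  refine Submodule.span_induction (p := fun w _ ↦
      PowerSeries.C (((p : ℕ) : PadicComplexInt p) ^ k) * w ∈ Ideal.span {constantCoeff G}) ?_ ?_ ?_ ?_ hw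
  · rintro _ ⟨y, hy, rfl⟩
    have h3 := hπ y hy
    rw [hkd, map_mul, mul_comm (PowerSeries.C c) (PowerSeries.C d), mul_assoc]
    exact Ideal.mul_mem_left _ _ h3
  · rw [mul_zero]; exact Ideal.zero_mem _
  · intro x y _ _ hx hy
    rw [mul_add]; exact Ideal.add_mem _ hx hy
  · intro r x _ hx
    rw [smul_eq_mul, mul_left_comm]
    exact Ideal.mul_mem_left _ r hx

/-! ### §4 (Appended, skeleton v24) The same with a DENOMINATOR: `𝓛 = A/B ∈ Frac`, `B(0,·) ≠ 0` -/

/-- **Away from the cyclotomic variable, FRACTIONAL form ⟹ up to a power of `p` on the anticyclotomic line.** In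
`𝒪_{ℂ_p}⟦T₂⟧⟦T₁⟧` let `I` be an ideal, `A, B` two-variable series (think `𝓛 = A/B ∈ Frac`, Castella–Liu–Wan's `𝓛_{π,𝒦,ξ} ∈
Frac(𝒪̂^{ur}⟦Γ_𝒦⟧)`), `h ∈ 𝒪_{ℂ_p}⟦T₁⟧` non-zero, with `h(T₁)·B·y ∈ (A)` for every `y ∈ I` («`(𝓛) ⊇ h·I`» as fractional ideals); and on
the anticyclotomic line `A(0,·) = B(0,·)·D` with `B(0,·) ≠ 0`, `D ≠ 0` («`𝓛(0,·) = D`»). Then `∃ k, ∀ w ∈ π(I), C(p^k)·w ∈ (D)`. (Cancel the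
power of `T₁` in `h` — `T₁ ∤ A` since `A(0,·) ≠ 0` —, apply `π`, cancel `B(0,·)` in the domain `𝒪_{ℂ_p}⟦T₂⟧`, absorb `h₁(0)` into `p^k`.)
[cite: CastellaLiuWan2022, Thm. 8.2.1 (1) («as fractional ideals of 𝒪^{ur}⟦Γ_𝒦⟧ ⊗_{𝒪⟦Γ⁺⟧} Frac 𝒪⟦Γ⁺⟧», 𝓛 ∈ Frac(𝒪̂^{ur}⟦Γ_𝒦⟧))] -/
theorem exists_C_pow_mul_mem_span_of_frac (I : Ideal (PowerSeries (PowerSeries (PadicComplexInt p))))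
    (A B : PowerSeries (PowerSeries (PadicComplexInt p))) (D : PowerSeries (PadicComplexInt p))
    (hB : constantCoeff B ≠ 0) (hD : D ≠ 0) (hAB : constantCoeff A = constantCoeff B * D)
    (h : PowerSeries (PadicComplexInt p)) (hh : h ≠ 0)
    (hincl : ∀ y ∈ I,
      PowerSeries.map (PowerSeries.C : PadicComplexInt p →+* PowerSeries (PadicComplexInt p)) h * B * y ∈
        Ideal.span {A}) :
    ∃ k : ℕ, ∀ w ∈ I.map (PowerSeries.constantCoeff (R := PowerSeries (PadicComplexInt p))),
      PowerSeries.C (((p : ℕ) : PadicComplexInt p) ^ k) * w ∈ Ideal.span {D} := by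
  set Cc : PadicComplexInt p →+* PowerSeries (PadicComplexInt p) := PowerSeries.C with hCc
  have hA : constantCoeff A ≠ 0 := by rw [hAB]; exact mul_ne_zero hB hD
  -- `h = T₁^a · h₁`, `h₁(0) ≠ 0`
  set a : ℕ := h.order.toNat with ha
  set h₁ : PowerSeries (PadicComplexInt p) := divXPowOrder h with hh₁
  have hfac : X ^ a * h₁ = h := X_pow_order_mul_divXPowOrder
  have hc : constantCoeff h₁ ≠ 0 := fun h0 ↦ hh (constantCoeff_divXPowOrder_eq_zero_iff.mp h0)
  set c : PadicComplexInt p := constantCoeff h₁ with hcdef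
  have hincl₁ : ∀ y ∈ I, PowerSeries.map Cc h₁ * B * y ∈ Ideal.span {A} := by
    intro y hy
    have h1 := hincl y hy
    rw [← hfac, map_mul, map_pow, map_X, mul_assoc, mul_assoc] at h1
    have h2 := mem_span_of_X_pow_mul_mem_span hA a h1
    rwa [← mul_assoc] at h2
  -- apply `π` and cancel `B(0,·)`: `C(c) · π y ∈ (D)`
  have hπ : ∀ y ∈ I, PowerSeries.C c * constantCoeff y ∈ Ideal.span {D} := by
    intro y hy
    obtain ⟨z, hz⟩ := Ideal.mem_span_singleton'.mp (hincl₁ y hy)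
    have h2 := congrArg (PowerSeries.constantCoeff (R := PowerSeries (PadicComplexInt p))) hz
    have hCm : PowerSeries.constantCoeff (PowerSeries.map Cc h₁) = Cc c := by
      rw [← PowerSeries.coeff_zero_eq_constantCoeff_apply, PowerSeries.coeff_map,
        PowerSeries.coeff_zero_eq_constantCoeff_apply]
    rw [map_mul, map_mul, map_mul, hCm, hAB] at h2
    -- `h2 : π z * (π B * D) = Cc c * π B * π y`
    refine Ideal.mem_span_singleton'.mpr ⟨constantCoeff z, ?_⟩
    have h3 : constantCoeff B * (constantCoeff z * D) = constantCoeff B * (Cc c * constantCoeff y) := by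
      calc constantCoeff B * (constantCoeff z * D) = constantCoeff z * (constantCoeff B * D) := by ring
        _ = Cc c * constantCoeff B * constantCoeff y := h2
        _ = constantCoeff B * (Cc c * constantCoeff y) := by ring
    exact mul_left_cancel₀ hB h3
  -- absorb `c` into a power of `p`
  obtain ⟨k, d, hkd⟩ := exists_pow_eq_mul c hc
  refine ⟨k, fun w hw ↦ ?_⟩
  rw [Ideal.map] at hw
  refine Submodule.span_induction (p := fun w _ ↦
      PowerSeries.C (((p : ℕ) : PadicComplexInt p) ^ k) * w ∈ Ideal.span {D}) ?_ ?_ ?_ ?_ hw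
  · rintro _ ⟨y, hy, rfl⟩
    have h3 := hπ y hy
    rw [hkd, map_mul, mul_comm (PowerSeries.C c) (PowerSeries.C d), mul_assoc]
    exact Ideal.mul_mem_left _ _ h3
  · rw [mul_zero]; exact Ideal.zero_mem _
  · intro x y _ _ hx hy
    rw [mul_add]; exact Ideal.add_mem _ hx hy
  · intro r x _ hx
    rw [smul_eq_mul, mul_left_comm]
    exact Ideal.mul_mem_left _ r hx

end Summit.BirchSwinnertonDyer.BirchSwinnertonDyer.Theorems.TameAwayFromCyc

end
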